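import Literature.NumberTheory.Transcendental.ZilberSaturationProofs
import HarnessLib

/-!
# Discharge of `BaysKirby2018_isQuasiminimal_of_isExpAlgClosed_of_ccp` (Bays–Kirby 2018, Cor. 11.7)

The named fact
`Literature.NumberTheory.Transcendental.BaysKirby2018_isQuasiminimal_of_isExpAlgClosed_of_ccp`
(`ZilberProofs.lean`; M. Bays, J. Kirby, *Pseudo-exponential maps, variants, and quasiminimality*,
Algebra & Number Theory 12 (2018) 493–549, arXiv:1512.04262, **Corollary 11.7** in the
exponential case of §9.1: "Suppose `F` is a full Γ-field with the countable closure property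
which is Γ-closed. Then `F` is quasiminimal", arXiv p. 38) **holds**, for fields in every
universe.

The tree contains the whole of Bays–Kirby's proof; this file only records the assembly:

* `BaysKirby2018_isQuasiminimal_of_isExpAlgClosed_of_ccp_of_saturation_univ`
  (`ZilberFieldQuasiminimalProps.lean`): Cor. 11.7 follows — by the back-and-forth / Karp
  argument of the proofs of Thm 6.9 and Thm 11.6 with `K = Γcl(∅)`, the countable closure
  property supplying the countable Γ-closed base — from `ℵ₀`-saturation of `F` for Γ-algebraic
  extensions purely Γ-transcendental over a countable Γ-closed `K`
  (the named fact `BaysKirby2018_saturation_of_isExpAlgClosed`, `ZilberSaturation.lean`);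
* `BaysKirby2018_saturation_of_isExpAlgClosed_holds` (`ZilberSaturationProofs.lean`): that
  saturation holds — Γ-closed ⟹ generically Γ-closed (Cor. 11.7, proof: "Clearly Γ-closedness
  implies generic Γ-closedness"; Zariski density of Γ-points,
  `BaysKirby2018_gammaPoints_dense_of_isExpAlgClosed_holds`), Prop. 11.5 (GΓC ⟹ GSΓC,
  `BaysKirby2018_prop_11_5_holds`: the horizontal weak Zilber–Pink theorem 11.4 over `ℂ`,
  `WeakZP.weakZPBound_complex`, transferred to every algebraically closed field of characteristic
  zero, `weakZPBound_of_isAlgClosed`) and Prop. 11.2 (GSΓC ⟹ `ℵ₀`-saturation,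
  `BaysKirby2018_prop_11_2_holds`).

With this discharge the decomposition of **Theorem 1.5** recorded in `ZilberProofs.lean` closes
along the printed assembly (p. 38: "Since `ℂ_exp` has the countable closure property by
Proposition 10.7, this completes the proof of Theorem 1.5"): the term
`isQuasiminimal_of_isExpAlgClosed_of_cor_11_7
  BaysKirby2018_isQuasiminimal_of_isExpAlgClosed_of_ccp_holds.{0}
  hasCountableClosureProperty_complex_holds`
has type `isQuasiminimal_of_isExpAlgClosed` (checked when this file was written; not restated as
a declaration because the tree's discharge of Thm 1.5 is `isQuasiminimal_of_isExpAlgClosed_holds`,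
`ZilberThm15.lean`, with the same statement).

This is a sibling of `ZilberProofs.lean` rather than an addition to it because every ingredient
above imports `ZilberProofs.lean` (`ZilberProofs` → `ZilberQuasiminimalProofs` →
`ZilberFieldQuasiminimalProps` → `ZilberProp112Corollaries` → `ZilberSaturationProofs`).

## References

* M. Bays, J. Kirby, *Pseudo-exponential maps, variants, and quasiminimality*, Algebra & Number
  Theory 12 (2018) 493–549 (arXiv:1512.04262): Thm 1.5, Def. 3.8, Thm 6.9, Def. 10.3,
  Prop. 10.7, Prop. 11.2, Thm 11.4, Prop. 11.5, Thm 11.6, Cor. 11.7 (arXiv p. 38).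
* B. Zilber, *Pseudo-exponentiation on algebraically closed fields of characteristic zero*,
  Ann. Pure Appl. Logic 132 (2005) 67–95, Lemma 5.12 (CCP for `ℂ_exp`).
-/

namespace Literature.NumberTheory.Transcendental

universe u

/-- **Bays–Kirby 2018, Corollary 11.7** (exponential case of §9.1) — the named fact
`BaysKirby2018_isQuasiminimal_of_isExpAlgClosed_of_ccp` **holds**, in every universe: an
exponential field of characteristic zero which is a full Γ-field (algebraically closed, `exp`
onto `Fˣ`; Def. 3.8), has the countable closure property and is exponentially-algebraically
closed (= Γ-closed, Def. 10.3) is quasiminimal — every subset of `F` definable with parameters in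
`⟨F; +, ·, exp⟩` is countable or co-countable. Proof: Cor. 11.7 from the saturation fact
(`BaysKirby2018_isQuasiminimal_of_isExpAlgClosed_of_ccp_of_saturation_univ`, Thm 11.6 with
`K = Γcl(∅)`), the saturation fact being proved
(`BaysKirby2018_saturation_of_isExpAlgClosed_holds`: density of Γ-points, Prop. 11.5 via the weak
Zilber–Pink theorem 11.4, Prop. 11.2). [cite: BaysKirby2018ANT, Cor. 11.7] -/
theorem BaysKirby2018_isQuasiminimal_of_isExpAlgClosed_of_ccp_holds :
    BaysKirby2018_isQuasiminimal_of_isExpAlgClosed_of_ccp.{u} :=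
  BaysKirby2018_isQuasiminimal_of_isExpAlgClosed_of_ccp_of_saturation_univ
    BaysKirby2018_saturation_of_isExpAlgClosed_holds

end Literature.NumberTheory.Transcendental
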